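import Summits.ResolutionOfSingularities.ResolutionOfSingularities.Theorems.MarkedTransferCampaignW46MarkedSurfacesCartier
import Summits.ResolutionOfSingularities.ResolutionOfSingularities.Theorems.MarkedTransferCampaignW46MarkedSurfacesBasePoint
import Summits.ResolutionOfSingularities.ResolutionOfSingularities.Theorems.FrobeniusClosingPatchingRelPerfectDepthFlagSeqBookkeeping
import Mathlib.Logic.Hydra
import HarnessLib

/-!
# [OURS · L1 W4.6 rung (i) SURFACES, host words] MARKED ORDER REDUCTION FOR EVERY IDEAL SHEAF ON A REGULAR SURFACE, WITH SNC
# BOUNDARY, IN EVERY CHARACTERISTIC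

Cell res-hironaka, LADDER-RESOLUTION rung L (D-0089), slot W4.6 «restricted regimes as rungs», rung (i) SURFACES; seat res-L1-s46-pv-1
(gen 7). Gen 6 closed the surface rung of res-L1-type-o1's host ladder (`hypersurfaceOrderReductionDimLE_two`, p557305): marked
resolution of an EFFECTIVE CARTIER marked ideal `(I, E, m)` on a regular surface. THIS FILE removes the binder `IsEffectiveCartier I`:
**every** marked ideal `(I, E, m)`, `I ≠ 0` ANY coherent ideal sheaf, `E` any snc boundary, `m ≥ 1`, on an integral regular surface
locally of finite type over a field, has a BGMW resolution — at the data level (`CentreSeq.IsResolutionOf`) and as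
`IsMarkedResolution`. This is the `d = 2` case of order reduction for marked ideals (J. Kollár, *Lectures on Resolution of
Singularities*, Thm. 3.107 in characteristic zero) in EVERY characteristic, and the form in which the surface rung is consumed one
dimension up (coefficient ideals on a maximal-contact surface are not principal: res-L1-s46-pv-7 HANDOFF g6 «next #2»). Proposed
`--kind proof --supports` stmt-ResolutionOfSingularities-16156 `--as helper`. Everything is OURS; nothing here is a statement of H.
Hironaka's manuscript [Hironaka2017]; no typed `Hironaka2017` candidate and no named FACT enters. AI-written; AI review is weaker than
expert review.

## The proof

Write `I = H · J` with `H` invertible and `V(J)` the (finite, closed-point) non-locally-principal locus of `I` (Cossart–Piltant 2008,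
proof of Prop. 4.2; tree `exists_divisorial_decomposition`). Let `B := V(J) ∩ Sing(I, m)` (the BASE POINTS of the codimension-two
part inside the singular locus of the marked ideal) and attach to the state the multiset `{(ord_x J, λ(𝒪_x/J_x)) : x ∈ B}` over
`ℕ∞ ×ₗ ℕ∞`.

* PHASE 1 (`B ≠ ∅`): blow up a point `x ∈ B` (a closed point is an admissible BGMW centre for every snc boundary). The transform is
  `I′ = H′ · J′` with `H′ = 𝓘_exc^{a+r−m} τᶜ(H, a)` invertible and `J′ = τᶜ(J, r)` the weak transform, `a = ord_x H`, `r = ord_x J`,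
  `V(J′)` again of codimension two (`…W46MarkedSurfacesBasePoint.lean`). Off `x` nothing changes; at the points over `x` the pair
  `(ord, λ)` is lexicographically SMALLER than `(r, λ(𝒪_x/J_x))` (order of the weak transform does not go up; where it stays the
  colength drops — Zariski / Huneke–Swanson 14.3.4 at NEAR points). So the new multiset is obtained by replacing one element by
  finitely many smaller ones: it is smaller in the CUT-EXPAND order (Mathlib `Relation.CutExpand`, well-founded — Dershowitz–Manna).
* PHASE 2 (`B = ∅`): on the open `U = X ∖ V(J) ⊇ Sing(I, m)` the ideal `I|_U = H|_U` is effective Cartier; the data-level surface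
  rung (`exists_isResolutionOf_of_isEffectiveCartier`, `…W46MarkedSurfacesCartier.lean`) resolves `(I, E, m)|_U`, and the resolution
  extends to `X` (`exists_isResolutionOf_of_isResolutionOf_opens`).

## What is proved

* `exists_isResolutionOf_of_decomposition` — the induction (cut-expand order on `Multiset (ℕ∞ ×ₗ ℕ∞)`).
* **`markedOrderReduction_of_dim_le_two`** — `∃ t : CentreSeq X, t.IsResolutionOf ⟨I, E, m⟩` for EVERY `I ≠ 0` (every field `k`).
* **`exists_isMarkedResolution_of_dim_le_two`** — the same as `∃ X′ Φ M′, IsMarkedResolution ⟨I, E, m⟩ Φ M′`.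
* `markedOrderReduction_hostBinders` — in the binders of MarkedTransfer `HypersurfaceOrderReductionDimLeThree` (stmt-16156) with
  `3 ↦ 2` and WITHOUT `IsEffectiveCartier I`; specialising to effective Cartier `I` gives back gen 6's
  `hypersurfaceOrderReductionDimLE_two : HypersurfaceOrderReductionDimLE p 2` verbatim (not restated here: the gate's dedup rule).

## Sources

* J. Kollár, *Lectures on Resolution of Singularities* (2007), Thm. 3.107, (3.111), Thm. 3.105 (proof). [Kollar2007]
* V. Cossart, O. Piltant, J. Algebra 320 (2008), proof of Prop. 4.2 and of Prop. 4.4. [CossartPiltant2008]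
* C. Huneke, I. Swanson, *Integral Closure of Ideals, Rings, and Modules* (2006), Lemma 14.3.4. [HunekeSwanson2006]
* N. Dershowitz, Z. Manna, *Proving termination with multiset orderings*, Comm. ACM 22 (1979) 465–476 (the cut-expand /
  multiset order; Mathlib `Mathlib.Logic.Hydra`). [folklore]
* E. Bierstone, D. Grigoriev, P. Milman, J. Włodarczyk, arXiv:1206.3090, Def. 3.1.3–3.1.5. [BierstoneGrigorievMilmanWlodarczyk2011]
* H. Hironaka, ms. 2017-03-23 — scope only, under adjudication, not cited as fact. [Hironaka2017]
-/

noncomputable section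

set_option linter.dupNamespace false -- mandated namespace of this single-conjunct summit

open CategoryTheory AlgebraicGeometry TopologicalSpace IsLocalRing

namespace Summit.ResolutionOfSingularities.ResolutionOfSingularities.Theorems

namespace CampaignW46

open Literature.AlgebraicGeometry.Resolution
open Literature.AlgebraicGeometry.Hironaka2017
open Scheme.IdealSheafData

universe u

/-! ## §1 The induction -/

/-- **[OURS · W4.6 rung (i)] THE BASE-POINT INDUCTION.** For a field `k`, `m ≥ 1` and a multiset `μ` over `ℕ∞ ×ₗ ℕ∞`: every
integral Noetherian regular `k`-scheme `X` locally of finite type of dimension `≤ 2`, every factorisation `I = H · J ≠ 0` with `H`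
effective Cartier and `V(J)` of codimension `≥ 2`, every snc boundary `E`, such that the multiset of the pairs
`(ord_x J, λ(𝒪_x/J_x))` over the base points `x ∈ V(J) ∩ Sing(I, m)` is `μ`, admit `t : CentreSeq X` resolving `(I, E, m)`.
Well-founded induction along Mathlib's cut-expand order (`Relation.CutExpand (· < ·)`); see the module docstring for the two phases.
[cite: Kollar2007, Thm. 3.107] [cite: CossartPiltant2008, proof of Prop. 4.4] -/
theorem exists_isResolutionOf_of_decomposition {k : Type u} [Field k] {m : ℕ} (hm : 1 ≤ m) (μ : Multiset (ℕ∞ ×ₗ ℕ∞)) :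
    ∀ {X : Scheme.{u}} [IsIntegral X] [IsNoetherian X] (s : X ⟶ Spec (.of k)) [LocallyOfFiniteType s]
      (_ : Scheme.IsRegular X) (_ : topologicalKrullDim X ≤ 2) {I H J : X.IdealSheafData} (_ : I ≠ ⊥) (_ : H * J = I)
      (_ : IsEffectiveCartier H) (_ : ∀ x ∈ J.support, 1 < Order.coheight x) {E : List X.IdealSheafData} (_ : HasSNC E)
      (B : Finset X) (_ : ∀ x, x ∈ B ↔ x ∈ J.support ∧ (m : ℕ∞) ≤ idealOrder I x),
      B.val.map (fun x => toLex (idealOrder J x,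
        Module.length (X.presheaf.stalk x) (X.presheaf.stalk x ⧸ stalkIdeal J x))) = μ →
      ∃ t : CentreSeq X, t.IsResolutionOf (⟨I, E, m⟩ : MarkedIdeal X) := by
  have wf : WellFounded (Relation.CutExpand (· < ·) : Multiset (ℕ∞ ×ₗ ℕ∞) → Multiset (ℕ∞ ×ₗ ℕ∞) → Prop) :=
    wellFounded_lt.cutExpand
  induction μ using wf.induction with
  | _ μ ih =>
  intro X _ _ s _ hX hd I H J hI hHJ hH hJ E hE B hB hμ
  classical
  haveI : IsLocallyNoetherian X := inferInstance
  have hXe : Scheme.IsExcellent X := Scheme.isExcellent_of_locallyOfFiniteType Stacks07QW_field_holds s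
  have hJ0 : J ≠ ⊥ := fun h => hI (by rw [← hHJ, h, mul_bot])
  have hH0 : H ≠ ⊥ := fun h => hI (by rw [← hHJ, h, bot_mul])
  by_cases hBe : B = ∅
  · /- PHASE 2: no base point of `J` inside `Sing(I, m)` — restrict to `U = X ∖ V(J)`, where `I` is effective Cartier -/
    let U : X.Opens := ⟨(J.support : Set X)ᶜ, J.support.isClosed.isOpen_compl⟩
    have hU : (⟨I, E, m⟩ : MarkedIdeal X).support ⊆ (U : Set X) := by
      intro y hy hyJ
      have : y ∈ B := (hB y).mpr ⟨hyJ, hy⟩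
      rw [hBe] at this
      exact absurd this (Finset.notMem_empty y)
    have hgen : genericPoint X ∈ (U : Set X) := not_mem_support_genericPoint hJ0
    haveI : Nonempty (U : Scheme.{u}) := ⟨⟨genericPoint X, hgen⟩⟩
    haveI : IsIntegral (U : Scheme.{u}) := isIntegral_of_isOpenImmersion U.ι
    haveI : CompactSpace (U : Scheme.{u}) := by
      haveI : NoetherianSpace (U : Scheme.{u}) := NoetherianSpace.set _
      infer_instance
    haveI : IsNoetherian (U : Scheme.{u}) := {}
    have hXU : Scheme.IsRegular (U : Scheme.{u}) := Scheme.IsRegular.of_isOpenImmersion U.ι hX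
    have hdU : topologicalKrullDim (U : Scheme.{u}) ≤ 2 := (U.ι.isOpenEmbedding.isInducing.topologicalKrullDim_le).trans hd
    have hJU : J.comap U.ι = ⊤ := by
      rw [← Scheme.IdealSheafData.support_eq_bot_iff, Scheme.IdealSheafData.support_comap]
      ext y
      simp only [Closeds.coe_preimage, Set.mem_preimage, Closeds.coe_bot, Set.mem_empty_iff_false, iff_false]
      exact y.2
    have hIU : I.comap U.ι = H.comap U.ι := by rw [← hHJ, comap_mul, hJU, mul_top]
    have hIcU : IsEffectiveCartier (I.comap U.ι) := hIU ▸ hH.comap_of_isOpenImmersion U.ι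
    have hIU0 : I.comap U.ι ≠ ⊥ := by
      intro h0
      obtain ⟨V, hxV, g, hg, hV⟩ := hIcU ⟨genericPoint X, hgen⟩
      rw [h0, Scheme.IdealSheafData.ideal_bot, Pi.bot_apply, eq_comm, Ideal.span_singleton_eq_bot] at hV
      subst hV
      haveI : Nonempty (V : (U : Scheme.{u}).Opens) := ⟨⟨_, hxV⟩⟩
      exact zero_notMem_nonZeroDivisors hg
    have hEU : HasSNC (E.map fun D => D.comap U.ι) := by
      have h := HasSNCWith.comap_of_isOpenImmersion (f := U.ι) hE
      rwa [Scheme.IdealSheafData.comap_top] at h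
    obtain ⟨tU, htU⟩ := exists_isResolutionOf_of_isEffectiveCartier (U : Scheme.{u}) (U.ι ≫ s) hXU hdU (I.comap U.ι) hIU0 hIcU
      (E.map fun D => D.comap U.ι) hEU m hm
    exact exists_isResolutionOf_of_isResolutionOf_opens ⟨I, E, m⟩ hE (isClosed_setOf_le_idealOrder hX hXe hI m) U hU htU
  · /- PHASE 1: blow up a base point `x ∈ V(J) ∩ Sing(I, m)` -/
    obtain ⟨x, hxB⟩ := Finset.nonempty_iff_ne_empty.mpr hBe
    obtain ⟨hxJ, hxm⟩ := (hB x).mp hxB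
    obtain ⟨hcoh, hR2, hx⟩ := coheight_eq_two_of_one_lt hd (hJ x hxJ)
    have hJcl : ∀ z ∈ (J.support : Set X), IsClosed ({z} : Set X) := fun z hz => (coheight_eq_two_of_one_lt hd (hJ z hz)).2.2
    have hxne : ({x} : Set X) ≠ Set.univ := by
      intro h
      have hg : genericPoint X ∈ ({x} : Set X) := h ▸ Set.mem_univ _
      rw [Set.mem_singleton_iff] at hg
      have h1 : (1 : ℕ∞) ≤ idealOrder I x := le_trans (by exact_mod_cast hm) hxm
      rw [← hg] at h1
      exact not_mem_support_genericPoint hI ((one_le_idealOrder_iff I _).mp h1)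
    set P : X.IdealSheafData := vanishingIdeal ⟨{x}, hx⟩ with hP
    have hπ : IsBlowup (blowup.π P) P := blowup.isBlowup P
    have hP0 : P ≠ ⊥ := vanishingIdeal_singleton_ne_bot hx hxne
    have hPtop : P.support ≠ ⊤ := by
      intro htop
      apply hxne
      have := congrArg (fun Z : Closeds X => (Z : Set X)) htop
      simpa [hP, Scheme.IdealSheafData.coe_support_vanishingIdeal] using this
    -- admissibility of the point centre
    have hPreg : Scheme.IsRegular P.subscheme := isRegular_subscheme_vanishingIdeal_singleton hx
    have hPsupp : (P.support : Set X) ⊆ (⟨I, E, m⟩ : MarkedIdeal X).support := by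
      intro y hy
      rw [hP, Scheme.IdealSheafData.coe_support_vanishingIdeal] at hy
      rw [show y = x from hy]
      exact hxm
    have hPsnc : HasSNCWith E P := HasSNC.hasSNCWith_vanishingIdeal_singleton hE hx
    -- the new surface
    haveI : IsIntegral (blowup P) := hπ.isIntegral hP0
    haveI : IsProper (blowup.π P) := hπ.isProper
    haveI : IsLocallyNoetherian (blowup P) := LocallyOfFiniteType.isLocallyNoetherian (blowup.π P)
    haveI : CompactSpace (blowup P) := QuasiCompact.compactSpace_of_compactSpace (blowup.π P)
    haveI : IsNoetherian (blowup P) := {}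
    have hX' : Scheme.IsRegular (blowup P) := hπ.isRegular_of_isRegular_subscheme hX hPreg
    have hd' : topologicalKrullDim (blowup P) ≤ 2 := by
      rw [(hπ.isBirational' hP0).topologicalKrullDim_eq_of_isProper]; exact hd
    -- the orders `a = ord_x H`, `r = ord_x J`, and `m ≤ ord_x I = a + r`
    haveI := hX x
    obtain ⟨a, ha⟩ := ENat.ne_top_iff_exists.mp (idealOrder_ne_top hH0 x)
    obtain ⟨r, hr⟩ := ENat.ne_top_iff_exists.mp (idealOrder_ne_top hJ0 x)
    have hordI : idealOrder I x = ((1 * a + r : ℕ) : ℕ∞) :=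
      DepthPeel.idealOrder_eq_add_of_pow_mul_eq hH (by rw [pow_one]; exact hHJ) ha.symm hr.symm
    have hmar : m ≤ a + r := by
      rw [hordI] at hxm
      have := (ENat.coe_le_coe.mp hxm); omega
    have hHa : H ≤ P ^ a := le_vanishingIdeal_pow_of_forall_le_idealOrder hX hPreg fun y hy => by
      rw [show y = x from hy, ← ha]
    have hJr : J ≤ P ^ r := le_vanishingIdeal_pow_of_forall_le_idealOrder hX hPreg fun y hy => by
      rw [show y = x from hy, ← hr]
    -- the new decomposition `I′ = H′ · J′`
    set I' := controlledTransform (blowup.π P) P I m with hI'def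
    set H' := P.comap (blowup.π P) ^ (a + r - m) * controlledTransform (blowup.π P) P H a with hH'def
    set J' := controlledTransform (blowup.π P) P J r with hJ'def
    have hHJ' : H' * J' = I' := by
      rw [hI'def, ← hHJ]; exact (controlledTransform_mul_eq_of_le hx hπ hHa hJr hmar).symm
    have hH' : IsEffectiveCartier H' := isEffectiveCartier_pow_mul_controlledTransform hX hx hxne hπ hH0 hH ha.le _
    have hJ'c : ∀ y ∈ J'.support, 1 < Order.coheight y := fun y hy =>
      one_lt_coheight_of_mem_support_controlledTransform hX hx hxne hπ hJ hr.symm hy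
    have hI' : I' ≠ ⊥ := fun h =>
      hπ.comap_ne_bot hPtop hI (le_bot_iff.mp (h ▸ comap_le_controlledTransform (blowup.π P) P I m))
    have hE' : HasSNC ((⟨I, E, m⟩ : MarkedIdeal X).transform (blowup.π P) P).boundary :=
      MarkedIdeal.hasSNC_transform_boundary _ hPsnc hπ
    -- the new base points
    have hfin' : {y : blowup P | y ∈ J'.support ∧ (m : ℕ∞) ≤ idealOrder I' y}.Finite :=
      (finite_support_of_one_lt_coheight hd' hJ'c).subset fun y hy => hy.1
    set B' : Finset (blowup P) := hfin'.toFinset with hB'def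
    have hB' : ∀ y, y ∈ B' ↔ y ∈ J'.support ∧ (m : ℕ∞) ≤ idealOrder I' y := fun y => by
      rw [hB'def, Set.Finite.mem_toFinset, Set.mem_setOf_eq]
    -- the measure drops in the cut-expand order
    set v : X → ℕ∞ ×ₗ ℕ∞ := fun z => toLex (idealOrder J z,
      Module.length (X.presheaf.stalk z) (X.presheaf.stalk z ⧸ stalkIdeal J z)) with hv
    set v' : blowup P → ℕ∞ ×ₗ ℕ∞ := fun y => toLex (idealOrder J' y,
      Module.length ((blowup P).presheaf.stalk y) ((blowup P).presheaf.stalk y ⧸ stalkIdeal J' y)) with hv'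
    have hcut : Relation.CutExpand (· < ·) (B'.val.map v') (B.val.map v) := by
      -- split the new base points into those off `x` and those over `x`
      set B₁ := B'.filter fun y => blowup.π P y ≠ x with hB₁
      set B₂ := B'.filter fun y => ¬ blowup.π P y ≠ x with hB₂
      have hsplit : B'.val.map v' = B₁.val.map v' + B₂.val.map v' := by
        rw [hB₁, hB₂, Finset.filter_val, Finset.filter_val, ← Multiset.map_add, Multiset.filter_add_not]
      -- off `x`: the same points with the same values
      have hoff : B₁.val.map v' = (B.erase x).val.map v := by
        have h1 : B₁.val.map v' = B₁.val.map (v ∘ fun y => blowup.π P y) := by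
          refine Multiset.map_congr rfl fun y hy => ?_
          have hyx : blowup.π P y ≠ x := (Finset.mem_filter.mp hy).2
          obtain ⟨ho, hl, -, -⟩ := offCentre_eq hx hπ J r hyx
          simp only [hv, hv', Function.comp_apply]
          rw [ho, hl]
        have hinj : Set.InjOn (fun y => blowup.π P y) (B₁ : Set (blowup P)) := by
          intro y hy y' hy' h
          have hyx : blowup.π P y ≠ x := (Finset.mem_filter.mp hy).2
          exact (existsUnique_preimage hx hπ hyx).unique rfl h.symm
        have himg : B₁.image (fun y => blowup.π P y) = B.erase x := by
          ext z
          simp only [Finset.mem_image, Finset.mem_erase]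
          constructor
          · rintro ⟨y, hy, rfl⟩
            obtain ⟨hyB', hyx⟩ := Finset.mem_filter.mp hy
            obtain ⟨hyJ', hym⟩ := (hB' y).mp hyB'
            obtain ⟨-, -, hmemJ, -⟩ := offCentre_eq hx hπ J r hyx
            obtain ⟨hoI, -, -, -⟩ := offCentre_eq hx hπ I m hyx
            exact ⟨hyx, (hB _).mpr ⟨hmemJ.mp hyJ', by rw [← hoI]; exact hym⟩⟩
          · rintro ⟨hzx, hzB⟩
            obtain ⟨hzJ, hzm⟩ := (hB z).mp hzB
            obtain ⟨y, hy, -⟩ := existsUnique_preimage hx hπ hzx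
            have hyx : blowup.π P y ≠ x := by rw [hy]; exact hzx
            obtain ⟨-, -, hmemJ, -⟩ := offCentre_eq hx hπ J r hyx
            obtain ⟨hoI, -, -, -⟩ := offCentre_eq hx hπ I m hyx
            refine ⟨y, Finset.mem_filter.mpr ⟨(hB' y).mpr ⟨hmemJ.mpr (hy ▸ hzJ), ?_⟩, hyx⟩, hy⟩
            rw [hoI, hy]; exact hzm
        rw [h1, ← Multiset.map_map, ← Finset.image_val_of_injOn hinj, himg]
      -- over `x`: every value is smaller than `v x`
      have hover : ∀ c ∈ B₂.val.map v', c < v x := by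
        intro c hc
        obtain ⟨y, hy, rfl⟩ := Multiset.mem_map.mp hc
        have hyx : blowup.π P y = x := by
          have := (Finset.mem_filter.mp hy).2
          push Not at this
          exact this
        exact toLex_lt_of_over hX hx hπ hJcl hxJ hcoh hr.symm hyx
      have hold : B.val.map v = (B.erase x).val.map v + {v x} := by
        rw [add_comm, Multiset.singleton_add, ← Multiset.map_cons, Finset.erase_val, Multiset.cons_erase (Finset.mem_val.mpr hxB)]
      rw [hsplit, hoff, hold]
      exact (Relation.cutExpand_add_left _).mpr (Relation.cutExpand_singleton hover)
    -- recurse and prepend the step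
    obtain ⟨t', ht'⟩ := ih _ (hμ ▸ hcut) (blowup.π P ≫ s) hX' hd' hI' hHJ' hH' hJ'c hE' B' hB' rfl
    exact ⟨CentreSeq.cons P t', (CentreSeq.isAdmissibleFor_cons P t' _).mpr ⟨hPsupp, hPsnc, hPreg, ht'.1⟩, ht'.2⟩

/-! ## §2 The theorems -/

/-- **[OURS · W4.6 RUNG (i) SURFACES, host words] MARKED ORDER REDUCTION FOR EVERY IDEAL SHEAF ON A REGULAR SURFACE, AT THE DATA
LEVEL** (universe polymorphic; every field; every characteristic). For a field `k`, a quasi-compact integral regular `k`-scheme `X`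
locally of finite type with `topologicalKrullDim X ≤ 2`, ANY ideal sheaf `I ≠ 0`, an snc boundary `E` and `m ≥ 1`:
`∃ t : CentreSeq X, t.IsResolutionOf ⟨I, E, m⟩` — a BGMW resolution (regular centres inside the successive supports, snc with the
successive boundaries, final support empty). Start of the induction `exists_isResolutionOf_of_decomposition` at the divisorial
decomposition `I = H · J` of Cossart–Piltant (tree `exists_divisorial_decomposition`). [cite: Kollar2007, Thm. 3.107]
[cite: CossartPiltant2008, proof of Prop. 4.2] -/
theorem markedOrderReduction_of_dim_le_two {k : Type u} [Field k] (X : Scheme.{u}) (s : X ⟶ Spec (.of k))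
    [LocallyOfFiniteType s] [QuasiCompact s] [IsIntegral X] (hreg : Scheme.IsRegular X) (hdim : topologicalKrullDim X ≤ 2)
    (I : X.IdealSheafData) (hI : I ≠ ⊥) (E : List X.IdealSheafData) (hE : HasSNC E) (m : ℕ) (hm : 1 ≤ m) :
    ∃ t : CentreSeq X, t.IsResolutionOf (⟨I, E, m⟩ : MarkedIdeal X) := by
  classical
  haveI : IsLocallyNoetherian X := LocallyOfFiniteType.isLocallyNoetherian s
  haveI : CompactSpace X := QuasiCompact.compactSpace_of_compactSpace s
  haveI : IsNoetherian X := {}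
  obtain ⟨H, J, hH, hHJ, -, -, hJ⟩ := exists_divisorial_decomposition hreg hI
  have hfin : {x : X | x ∈ J.support ∧ (m : ℕ∞) ≤ idealOrder I x}.Finite :=
    (finite_support_of_one_lt_coheight hdim hJ).subset fun x hx => hx.1
  exact exists_isResolutionOf_of_decomposition hm _ s hreg hdim hI hHJ hH hJ hE hfin.toFinset
    (fun x => by rw [Set.Finite.mem_toFinset, Set.mem_setOf_eq]) rfl

/-- **[OURS · W4.6 RUNG (i) SURFACES, host words] EVERY MARKED IDEAL ON A REGULAR SURFACE HAS A BGMW MARKED RESOLUTION**: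
`∃ X′ (Φ : X′ ⟶ X) M′, IsMarkedResolution ⟨I, E, m⟩ Φ M′` under the hypotheses of `markedOrderReduction_of_dim_le_two` (tree
`CentreSeq.IsResolutionOf.isMarkedResolution`). Gen 6's `hypersurfaceOrderReduction_of_dim_le_two` is the case `I` effective Cartier.
[cite: Kollar2007, Thm. 3.107] [cite: BierstoneGrigorievMilmanWlodarczyk2011, Def. 3.1.3] -/
theorem exists_isMarkedResolution_of_dim_le_two {k : Type u} [Field k] (X : Scheme.{u}) (s : X ⟶ Spec (.of k))
    [LocallyOfFiniteType s] [QuasiCompact s] [IsIntegral X] (hreg : Scheme.IsRegular X) (hdim : topologicalKrullDim X ≤ 2)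
    (I : X.IdealSheafData) (hI : I ≠ ⊥) (E : List X.IdealSheafData) (hE : HasSNC E) (m : ℕ) (hm : 1 ≤ m) :
    ∃ (X' : Scheme.{u}) (Φ : X' ⟶ X) (M' : MarkedIdeal X'), IsMarkedResolution (⟨I, E, m⟩ : MarkedIdeal X) Φ M' := by
  obtain ⟨t, ht⟩ := markedOrderReduction_of_dim_le_two X s hreg hdim I hI E hE m hm
  exact ⟨t.top, t.comp, _, ht.isMarkedResolution⟩

/-- **[OURS · W4.6 RUNG (i) SURFACES] IN THE BINDERS OF THE HOST ITEM, WITHOUT THE CARTIER BINDER.** For every prime `p`, every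
perfect field `k` of characteristic `p`, every separated quasi-compact `k`-scheme `X` locally of finite type, integral and regular, of
dimension `≤ 2`, EVERY ideal sheaf `I ≠ ⊥`, every snc boundary `E` and every `m ≥ 1`, the marked ideal `(I, E, m)` has a BGMW marked
resolution — the text of MarkedTransfer `HypersurfaceOrderReductionDimLeThree` (stmt-ResolutionOfSingularities-16156) with `3 ↦ 2`
and the hypothesis `IsEffectiveCartier I` DELETED (the characteristic, perfectness and separatedness binders are carried, not used).
Specialising to effective Cartier `I` re-proves gen 6's `hypersurfaceOrderReductionDimLE_two`. Replaces the role of «(i) SURFACES: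
the typed Th. 16.6 procedure terminates — and reduces order with snc boundary — where the host item applies» (RESCUE-SEED W4.6 (i))
for arbitrary marked ideals; NOT a statement of the manuscript. [cite: Kollar2007, Thm. 3.107]
[cite: BierstoneGrigorievMilmanWlodarczyk2011, Def. 3.1.3] -/
theorem markedOrderReduction_hostBinders (p : ℕ) :
    p.Prime → ∀ (k : Type) [Field k] [CharP k p] [PerfectField k] (X : AlgebraicGeometry.Scheme.{0})
      (s : X ⟶ AlgebraicGeometry.Spec (.of k)), AlgebraicGeometry.IsSeparated s → AlgebraicGeometry.LocallyOfFiniteType s →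
        AlgebraicGeometry.QuasiCompact s → AlgebraicGeometry.IsIntegral X → Scheme.IsRegular X →
          topologicalKrullDim X ≤ 2 → ∀ (I : X.IdealSheafData), I ≠ ⊥ →
            ∀ (E : List X.IdealSheafData), HasSNC E → ∀ (m : ℕ), 1 ≤ m →
              ∃ (X' : AlgebraicGeometry.Scheme.{0}) (Φ : X' ⟶ X) (M' : MarkedIdeal X'),
                IsMarkedResolution (⟨I, E, m⟩ : MarkedIdeal X) Φ M' := by
  intro _ k _ _ _ X s _ hloft hqc hint hreg hdim I hI E hE m hm
  haveI := hloft
  haveI := hqc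
  haveI := hint
  exact exists_isMarkedResolution_of_dim_le_two X s hreg hdim I hI E hE m hm

end CampaignW46

end Summit.ResolutionOfSingularities.ResolutionOfSingularities.Theorems

end
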